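import Literature.NumberTheory.Automorphic.QuaternionAlgebraEmbeddingHolds
import Literature.NumberTheory.Automorphic.QuaternionAlgebraSplitting
import HarnessLib

/-!
# Norm-one quaternions with prescribed reduced trace (Vignéras III §4, from Thm. 3.8)

Topic `NumberTheory/Automorphic`; theorems only (no definition, no named fact). The existence
input of Kneser's strong approximation theorem for the norm-one group of a quaternion algebra
`H = ℍ[K,a,b]` over a number field (Vignéras, LNM 800, Ch. III §4, proof of Thm. 4.3, and of the
norm theorem Thm. 4.1): *for `t ∈ K` such that the quadratic algebra `L = K[X]/(X² - tX + 1)` is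
a field locally at every place ramified in `H`, `L` embeds in `H` (Thm. 3.8), i.e. `H` contains an
element `y` with `y ȳ = 1` and `y + ȳ = t`.* Here `L ≅ K(√(t² - 4))`, so the local conditions are
"`t² - 4` is not a square in `K_v`" at the ramified places, and Thm. 3.8 (first assertion) is the
tree's PROVED `exists_sq_eq_of_not_isSquare_ramified_holds` (`QuaternionAlgebraEmbeddingHolds`):
an `x ∈ H` with `x² = t² - 4` exists; as `t² - 4` is not a square in `K`, `x ∉ K`, so `x` is pure
(`x̄ = -x`) and `y = (t + x)/2` has `y ȳ = (t² - x²)/4 = 1`, `y + ȳ = t`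
(`exists_mul_star_eq_one_add_star_eq`).

## References

* M.-F. Vignéras, *Arithmétique des algèbres de quaternions*, LNM 800 (1980), Ch. III §3
  Thm. 3.8, §4 Thm. 4.1 and Thm. 4.3 (proofs) [VignerasLNM800].
-/

noncomputable section

open scoped Quaternion
open NumberField IsDedekindDomain

namespace Literature.NumberTheory.Automorphic

namespace QuaternionAlgebra

/-- `ℍ⟮K; R; a, b⟯ := ℍ[K, algebraMap R K a, algebraMap R K b]` (file-local notation, as in
`QuaternionCoordOrder`). -/
local notation "ℍ⟮" K "; " R "; " a ", " b "⟯" =>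
  QuaternionAlgebra K (algebraMap R K a) (0 : K) (algebraMap R K b)

section Pure

variable {F : Type*} [Field F] {c₁ c₃ : F}

/-- A square root in `ℍ[F,c₁,c₃]` (`2 ≠ 0` in `F`) of a scalar which is not a square in `F` is a
**pure quaternion** (`x₀ = 0`): from `x² = d` the imaginary coordinates of `x²` are `2 x₀ xᵢ = 0`,
and `x₀ ≠ 0` would force `x ∈ F`, `d = x₀²` (Vignéras I §1: the minimal polynomial of `h ∉ K`
is `X² - t(h)X + n(h)`, so `h² ∈ K` iff `t(h) = 0`). [cite: VignerasLNM800, Ch. I §1 Lemme 1.1] -/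
theorem re_eq_zero_of_mul_self_eq_algebraMap [NeZero (2 : F)] {x : ℍ[F,c₁,c₃]} {d : F}
    (hd : ¬ IsSquare d) (hx : x * x = algebraMap F ℍ[F,c₁,c₃] d) : x.re = 0 := by
  by_contra h0
  have h1 := congrArg _root_.QuaternionAlgebra.imI hx
  have h2 := congrArg _root_.QuaternionAlgebra.imJ hx
  have h3 := congrArg _root_.QuaternionAlgebra.imK hx
  have hre := congrArg _root_.QuaternionAlgebra.re hx
  rw [_root_.QuaternionAlgebra.algebraMap_eq] at h1 h2 h3 hre
  simp only [_root_.QuaternionAlgebra.imI_mul, _root_.QuaternionAlgebra.imJ_mul,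
    _root_.QuaternionAlgebra.imK_mul, _root_.QuaternionAlgebra.re_mul, zero_mul,
    add_zero] at h1 h2 h3 hre
  have h2' : (2 : F) ≠ 0 := two_ne_zero
  have hI : x.imI = 0 := by
    have h : 2 * x.re * x.imI = 0 := by linear_combination h1
    simpa [h2', h0] using h
  have hJ : x.imJ = 0 := by
    have h : 2 * x.re * x.imJ = 0 := by linear_combination h2
    simpa [h2', h0] using h
  have hK : x.imK = 0 := by
    have h : 2 * x.re * x.imK = 0 := by linear_combination h3
    simpa [h2', h0] using h
  apply hd
  refine ⟨x.re, ?_⟩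
  rw [hI, hJ, hK] at hre
  linear_combination -hre

/-- A pure quaternion is anti-invariant under conjugation: `x̄ = -x` when `x₀ = 0`. [folklore] -/
theorem star_eq_neg_of_re_eq_zero {x : ℍ[F,c₁,c₃]} (h : x.re = 0) : star x = -x := by
  ext <;> simp [h]

end Pure

section NumberField

variable {K : Type} [Field K] [NumberField K] (a b : 𝓞 K)

/-- **Norm-one quaternions with prescribed reduced trace** (Vignéras III §4, proofs of Thm. 4.1 and
Thm. 4.3, from Thm. 3.8): let `a, b ∈ 𝓞 K ∖ 0` and `t ∈ K` with `t² - 4` not a square in `K`, nor in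
`K_v` for the finite places `v` ramified in `ℍ[K,a,b]`, nor in `K_w` for the infinite places `w`
ramified in `ℍ[K,a,b]` (i.e. `K(√(t² - 4)) = K[X]/(X² - tX + 1)` is a field locally at `Ram(H)`).
Then there is `y ∈ ℍ[K,a,b]` with `y ȳ = 1` and `y + ȳ = t`: `y = (t + x)/2` for a square root `x`
of `t² - 4` in `ℍ[K,a,b]` (`exists_sq_eq_of_not_isSquare_ramified_holds`, Vignéras III Thm. 3.8),
which is pure. [cite: VignerasLNM800, Ch. III §3 Thm. 3.8 and §4 (proof of Thm. 4.3)] -/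
theorem exists_mul_star_eq_one_add_star_eq (ha : a ≠ 0) (hb : b ≠ 0) (t : K)
    (hK : ¬ IsSquare (t ^ 2 - 4))
    (hfin : ∀ v ∈ ramifiedPlaces K ℍ⟮K; 𝓞 K; a, b⟯,
      ¬ IsSquare (algebraMap K (v.adicCompletion K) (t ^ 2 - 4)))
    (hinf : ∀ w ∈ ramifiedInfinitePlaces K ℍ⟮K; 𝓞 K; a, b⟯,
      ¬ IsSquare (algebraMap K w.Completion (t ^ 2 - 4))) :
    ∃ y : ℍ⟮K; 𝓞 K; a, b⟯, y * star y = 1 ∧ y + star y = algebraMap K ℍ⟮K; 𝓞 K; a, b⟯ t := by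
  have hinj := FaithfulSMul.algebraMap_injective (𝓞 K) K
  haveI : IsQuaternionAlgebra K ℍ⟮K; 𝓞 K; a, b⟯ :=
    QuaternionAlgebra.isQuaternionAlgebra_holds ((map_ne_zero_iff _ hinj).mpr ha)
      ((map_ne_zero_iff _ hinj).mpr hb)
  obtain ⟨x, hx⟩ := exists_sq_eq_of_not_isSquare_ramified_holds K ℍ⟮K; 𝓞 K; a, b⟯ (t ^ 2 - 4)
    hK hfin hinf
  have h0 : x.re = 0 := re_eq_zero_of_mul_self_eq_algebraMap hK hx
  have hre := congrArg _root_.QuaternionAlgebra.re hx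
  rw [_root_.QuaternionAlgebra.algebraMap_eq] at hre
  simp only [_root_.QuaternionAlgebra.re_mul, h0, zero_mul, mul_zero, add_zero, zero_add] at hre
  -- `y = (t + x)/2`
  refine ⟨⟨t / 2, x.imI / 2, x.imJ / 2, x.imK / 2⟩, ?_, ?_⟩
  · rw [self_mul_star_eq_algebraMap, ← map_one (algebraMap K ℍ⟮K; 𝓞 K; a, b⟯)]
    congr 1
    linear_combination (-(1 : K) / 4) * hre
  · rw [_root_.QuaternionAlgebra.algebraMap_eq]
    ext <;> simp

end NumberField

end QuaternionAlgebra

end Literature.NumberTheory.Automorphic
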